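import Summits.AtomisticToContinuum.Crystallization.Theorems.ExcessDecayLiouvilleChainRun
import Summits.AtomisticToContinuum.Crystallization.Theorems.ExcessDecayLiouvilleChainLast
import Summits.AtomisticToContinuum.Crystallization.Theorems.ExcessDecayLiouvillePhaseOne
import Summits.AtomisticToContinuum.Crystallization.Theorems.ExcessDecayLiouvillePhaseOneArith
import Summits.AtomisticToContinuum.Crystallization.Theorems.ExcessDecayLiouvilleParamArithA
import Summits.AtomisticToContinuum.Crystallization.Theorems.ExcessDecayLiouvilleParamArithB
import Summits.AtomisticToContinuum.Crystallization.Theorems.ExcessDecayLiouvilleParamArithE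
import Summits.AtomisticToContinuum.Crystallization.Theorems.ExcessDecayLiouvilleParamArithI
import Summits.AtomisticToContinuum.Crystallization.Theorems.ExcessDecayLiouvilleEndgame
import Summits.AtomisticToContinuum.Crystallization.Theorems.ExcessDecayLiouvilleBaseCase
import Summits.AtomisticToContinuum.Crystallization.Theorems.ExcessDecayLiouvilleExcessDecay
import Summits.AtomisticToContinuum.Crystallization.Theorems.ExcessDecayLiouvilleEnergyIdentity

/-!
# Route `ExcessDecayLiouville`: the proof of `ExcessDecay` (assembly)

Harmonic-replacement architecture for item `ExcessDecay` (stmt-AtomisticToContinuum-9334).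
`excessDecayReducedAt_of`: harmonic stability (`PhononStability`, through `coercive_of_phononStability`) gives
the reduced excess decay `ExcessDecayReducedAt δ` for every `0 < δ ≤ 1`, with the parameters
`ε₀ = δ/L¹⁰⁰⁰`, `θ = 1/(64L⁹⁰)`, `r₀ = L¹⁰⁰⁰/δ¹⁰`, `C = L⁴⁰⁰/δ¹⁰` (`L = lcOf κ`): matching map, base
relaxation, phase one (`phase_one`) at the top scale `σ⋆² = (r − 153600)/737600`, the mass constant `C₁`
(`phase1_constant_le`), the chain of `K₀` scales down to `L¹⁷` at every site of `B_{σ₀²}(c)` (`pointwise_bound`: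
`chainInv_init`, `chain_run`, `last_scale`),
the parameter arithmetic (`ExcessDecayLiouvilleParamArith*`), and the endgame `near_of_envelope`.
`excessDecay_proof : ExcessDecay` then follows from `excessDecay_of_reduced`.
-/

noncomputable section

namespace Summit.AtomisticToContinuum.Crystallization.Theorems.ExcessDecayLiouville

open scoped BigOperators Topology InnerProductSpace RealInnerProductSpace Classical
open Literature.MathematicalPhysics.StatisticalMechanics
open Summit.AtomisticToContinuum.Crystallization.Theorems.PhononStabilityNegative

local notation "E3" => EuclideanSpace ℝ (Fin 3)

-- Local notation: the force-constant map `K(e)w = h(|e|²)w + 2⟪e,w⟫h′(|e|²)e`.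
local notation3 "𝕂[" e "] " w:max =>
  (-((‖e‖ ^ 2)⁻¹) ^ 7 + ((‖e‖ ^ 2)⁻¹) ^ 4) • w + (2 * ⟪e, w⟫ * (7 * ((‖e‖ ^ 2)⁻¹) ^ 8 - 4 * ((‖e‖ ^ 2)⁻¹) ^ 5)) • e
-- Local notation: the pair force `F(x) = h(|x|²) x`.
local notation3 "𝐅[" x "]" => ((-((‖x‖ ^ 2)⁻¹) ^ 7 + ((‖x‖ ^ 2)⁻¹) ^ 4) • x)
set_option quotPrecheck false in
-- Local notation: ball indicator.
local notation "𝟙ᵇ[" x ", " c ", " R "]" => (if dist (x : EuclideanSpace ℝ (Fin 3)) c ≤ R then (1 : ℝ) else 0)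

section

variable {X : Set E3} {c : E3} {r ε δ κ : ℝ} {t : Fin 2 → E3} {A : E3 →L[ℝ] E3} {π : E3 → E3}
  {aff₀ aff : E3 → E3} {a : Fin 2 → E3} {B : E3 →L[ℝ] E3} {c₀ : E3}

variable (hA : Adm₀ A) (hI : Inner₀ t A)

set_option quotPrecheck false in
-- Local notation: the operator row `(L v)(p)`.
local notation "𝕃" v:max " @ " p:max =>
  tsum (fun q : Sites₀ t A => (if ((p : Sites₀ t A) : E3) ≠ q then 𝕂[((p : Sites₀ t A) : E3) - q] (v ((p : Sites₀ t A) : E3) - v q) else 0))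
set_option quotPrecheck false in
-- Local notation: the finite near-neighbour form on the ball of radius `X` about `c₀`.
local notation "NN[" v ", " X "]" =>
  (∑ p ∈ (finite_sites_dist_le (t := t) (A := A) hA hI c₀ X).toFinset,
    ∑ q ∈ (finite_sites_dist_le (t := t) (A := A) hA hI c₀ X).toFinset,
      (if p ≠ q ∧ dist p q ≤ 11 / 10 then ‖v p - v q‖ ^ 2 else (0 : ℝ)))
set_option quotPrecheck false in
-- local mass on the ball of radius `X` about `c₀`
local notation "𝐌[" f ", " X "]" =>
  tsum (fun p : Sites₀ t A => ‖f (p : E3)‖ ^ 2 * 𝟙ᵇ[p, c₀, X])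
set_option quotPrecheck false in
-- Local notation: the displaced self-force `G(p)` of the background `aff`.
local notation "𝐆[" aff "] " p:max =>
  tsum (fun q : Sites₀ t A => (if (p : E3) ≠ q then 𝐅[((p : E3) - q) + (aff (p : E3) - aff q)] else 0))
set_option quotPrecheck false in
-- Local notation: the radial site cut-off `= 1` on the sites of `B_{r₁}(c)`, `0` beyond `r₁ + w`, slope `1/w`.
local notation "𝛘[" r₁ ", " w "]" =>
  (fun x : EuclideanSpace ℝ (Fin 3) => (if x ∈ Sites₀ t A then max (min 1 ((r₁ + w - dist x c) / w)) 0 else 0))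

include hA hI in
/-- **The pointwise bound at every site of the small ball** (see the module docstring). [folklore] -/
theorem pointwise_bound (hκ0 : 0 < κ) (hκ1 : κ ≤ 1)
    (hκ : ∀ v : E3 → E3, (Function.support v).Finite →
      Function.support v ⊆ Sites₀ t A → κ * nnForm t A v ≤ ∑' p : Sites₀ t A, ⟪𝕃 v @ p, v p⟫)
    (hX : X.Finite) (hsep : Sep₀ X δ) (hequil : Equil₀ X) (hδ : 0 < δ) (hδ1 : δ ≤ 1)
    (hε0 : 0 ≤ ε) (hε : 2 * ε < δ) (hr : 192 ≤ r)
    (hXb : ∀ p ∈ X, dist p c ≤ r → ∃ m : Fin 2, ∃ z ∈ Λ₀, dist p (t m + A z) ≤ ε)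
    (hπ : ∀ s' ∈ Sites₀ t A, dist s' c ≤ r → π s' ∈ X ∧ dist (π s') s' ≤ ε)
    (hinj : ∀ s₁ ∈ Sites₀ t A, ∀ s₂ ∈ Sites₀ t A, dist s₁ c ≤ r → dist s₂ c ≤ r → π s₁ = π s₂ → s₁ = s₂)
    (SR : Finset E3) (hSR : ∀ x, x ∈ SR ↔ x ∈ Sites₀ t A ∧ dist x c ≤ r)
    {aff₀ : E3 → E3} {a₀ : Fin 2 → E3} {B₀ : E3 →L[ℝ] E3}
    (haff₀ : ∀ (m : Fin 2) (z : E3), z ∈ Λ₀ → aff₀ (t m + A z) = a₀ m + B₀ (t m + A z - c))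
    (hrel₀ : ∀ p : Sites₀ t A, 𝐆[aff₀] p = 0)
    {C₁ σ₀ : ℝ} (hC₁ : 0 ≤ C₁)
    (hmass₀ : ∀ Y : ℝ, 1 ≤ Y → σ₀ ^ 2 ≤ Y → Y ≤ r / 2 →
      (∑' p : Sites₀ t A, ‖(fun x : E3 => 𝛘[r / 2, r / 4] x • ((π x - x) - aff₀ x)) (p : E3)‖ ^ 2 * 𝟙ᵇ[p, c, Y]) ≤ 32 * C₁ * Y ^ 6)
    (hσ₀4 : σ₀ ^ 2 ≤ r / 4) (hσ₀8 : σ₀ ^ 2 ≤ r / 8) (hL17 : lcOf κ ^ 17 ≤ σ₀)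
    {K₀ : ℕ} (hσ₀K : σ₀ / (4 * lcOf κ ^ 10) ^ K₀ = lcOf κ ^ 17)
    {Du ν Λs γ₀ Ustar Vstar b₀ j₀ Du₀ ja jb : ℝ} (hDu0 : 0 ≤ Du) (hDu1 : Du ≤ 1 / 20) (hν : 0 ≤ ν) (hγ₀ : 0 ≤ γ₀)
    (hγC : 64 * C₁ ≤ γ₀ ^ 2) (hb₀ : ‖B₀‖ ≤ b₀) (hj₀ : ‖a₀ 0 - a₀ 1‖ ≤ j₀)
    (hU : 2 * (γ₀ * σ₀) + 2 * (σ₀ ^ 2 * (phiOf Du r δ + ν)) ≤ Ustar) (hV : 2 * vAgg σ₀ γ₀ (phiOf Du r δ) Du r ≤ Vstar)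
    (hN : ntotGen κ r δ ε Du ja jb ≤ ν ^ 2 * r ^ 7)
    (Cja : j₀ + 2 * lcOf κ ^ 13 * (Ustar + Du / r ^ 2) ≤ ja) (hja : ja ≤ 1 / 100)
    (Cjb : b₀ + 12 * lcOf κ ^ 8 * (Ustar + Du / r ^ 2) ≤ jb)
    (CΛ : 4000000 * (210000 * ((25 / 23) * (2 * Du + ja) + jb)) ≤ κ / 12)
    (hσ₀r : 737600 * σ₀ ^ 2 + 153600 ≤ r)
    (hDu₀ : ∀ x ∈ SR, ‖(π x - x) - aff₀ x‖ ≤ Du₀)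
    (C1 : lcOf κ ^ 13 * (Ustar / 2 + Du / (4 * r ^ 2)) ≤ κ ^ 2 / 10 ^ 11)
    (C2a : j₀ + 2 * lcOf κ ^ 13 * (Ustar + Du / r ^ 2) ≤ κ / (2 * 10 ^ 10))
    (C2b : b₀ + 12 * lcOf κ ^ 8 * (Ustar + Du / r ^ 2) ≤ κ / (2 * 10 ^ 10))
    (C2c : 2 * r * (b₀ + 12 * lcOf κ ^ 8 * (Ustar + Du / r ^ 2)) ≤ 1 / 100)
    (C3 : Du₀ + lcOf κ ^ 8 * Vstar +
      (lcOf κ ^ 13 + 14 * lcOf κ ^ 8 + 12 * lcOf κ ^ 8 * (5 * r / 4 + 11 / 10)) * (Ustar + Du / r ^ 2) ≤ Du)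
    (C4a : 4000000 * lamOf Du (j₀ + 2 * lcOf κ ^ 13 * (Ustar + Du / r ^ 2)) (b₀ + 12 * lcOf κ ^ 8 * (Ustar + Du / r ^ 2)) ≤ κ / 16)
    (C4b : lamOf Du (j₀ + 2 * lcOf κ ^ 13 * (Ustar + Du / r ^ 2)) (b₀ + 12 * lcOf κ ^ 8 * (Ustar + Du / r ^ 2)) ≤ Λs)
    (C4c : lcOf κ ^ 113 * Λs ^ 2 ≤ 1) (hΛs0 : 0 ≤ Λs)
    (C5 : lcOf κ ^ 114 * floorAgg σ₀ (phiOf Du r δ) ν Du r ≤ γ₀ ^ 2)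
    {s : E3} (hs : s ∈ Sites₀ t A) (hsd : dist s c ≤ σ₀ ^ 2) :
    ‖(π s - s) - aff₀ s‖ ≤
      lcOf κ ^ 8 * Vstar + (3 * lcOf κ ^ 13 + 28 * lcOf κ ^ 8) * (Ustar + Du / r ^ 2) +
        lcOf κ ^ 6 * ((1 + Λs * (lcOf κ ^ 17) ^ 6) * (Ustar + Du / r ^ 2) + (lcOf κ ^ 17) ^ 7 * phiOf Du r δ +
          (lcOf κ ^ 17) ^ 4 * Du / r ^ 2) := by
  obtain ⟨hL, -, -⟩ := lcOf_ge hκ0 hκ1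
  have hLpos : 0 < lcOf κ := lt_of_lt_of_le (by norm_num) hL
  have hr0 : 0 < r := by linarith
  have hc₀ : dist s c ≤ r / 8 := hsd.trans hσ₀8
  -- the initial state of the chain centred at s
  have hinit := chainInv_init hA hI (c := c) (π := π) hr0 haff₀ hrel₀ hC₁ hmass₀ hsd hσ₀4 (L := lcOf κ)
    (Φ := phiOf Du r δ) (ν := ν) (Du := Du) (Ustar := Ustar) (Vstar := Vstar) hL17 hγC hb₀ hj₀ hDu0 hLpos hU hV
  -- run K₀ scales
  obtain ⟨U', Vb', affK, aK, BK, hinvK⟩ := chain_run hA hI hκ0 hκ1 hκ hX hsep hequil hδ hδ1 hε0 hε hr hXb hπ hinj SR hSR hc₀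
    hDu0 hDu1 hν hγ₀ hN Cja hja Cjb CΛ hσ₀r hDu₀ C1 C2a C2b C2c C3 C4a C4b C4c C5 K₀ hinit (by rw [hσ₀K])
  -- read off the centre at the last scale
  have h := last_scale hA hI hκ0 hκ1 hκ hX hsep hequil hδ hδ1 hε0 hε hr hXb hπ hinj SR hSR hc₀ hs hDu0 hDu1 hν hγ₀ hN
    Cja hja Cjb CΛ hσ₀r hDu₀ C1 C2a C2b C2c C3 C4a C4b hΛs0 hinvK
  rw [hσ₀K] at h
  exact h

/-- **The choice of the number of scales**: a natural `K₀` with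
`r/(16L⁹⁰) < L³⁴(16L²⁰)^{K₀} ≤ r/L⁷⁰` (`L ≥ 2`, `L¹⁰⁴ ≤ r`). [folklore] -/
theorem exists_scale_count {L r : ℝ} (hL : 2 ≤ L) (hr : L ^ 104 ≤ r) :
    ∃ K₀ : ℕ, L ^ 34 * (16 * L ^ 20) ^ K₀ ≤ r / L ^ 70 ∧ r / L ^ 70 < 16 * L ^ 20 * (L ^ 34 * (16 * L ^ 20) ^ K₀) := by
  classical
  have hL0 : 0 < L := by linarith
  have hb : (1 : ℝ) < 16 * L ^ 20 := by nlinarith [one_le_pow₀ (n := 20) (by linarith : (1 : ℝ) ≤ L)]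
  have hex : ∃ n : ℕ, r / L ^ 70 < L ^ 34 * (16 * L ^ 20) ^ (n + 1) := by
    obtain ⟨n, hn⟩ := pow_unbounded_of_one_lt (r / L ^ 70) hb
    refine ⟨n, hn.trans_le ?_⟩
    have h1 : (1 : ℝ) ≤ L ^ 34 := one_le_pow₀ (by linarith)
    calc (16 * L ^ 20) ^ n = 1 * ((16 * L ^ 20) ^ n * 1) := by ring
      _ ≤ L ^ 34 * ((16 * L ^ 20) ^ n * (16 * L ^ 20)) := by
          refine mul_le_mul h1 (mul_le_mul_of_nonneg_left hb.le (by positivity)) (by positivity) (by positivity)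
      _ = L ^ 34 * (16 * L ^ 20) ^ (n + 1) := by ring
  refine ⟨Nat.find hex, ?_, ?_⟩
  · rcases Nat.eq_zero_or_pos (Nat.find hex) with h0 | hpos
    · rw [h0, pow_zero, mul_one, le_div_iff₀ (by positivity)]
      calc L ^ 34 * L ^ 70 = L ^ 104 := by ring
        _ ≤ r := hr
    · have hm := Nat.find_min hex (m := Nat.find hex - 1) (by omega)
      rw [not_lt, show Nat.find hex - 1 + 1 = Nat.find hex by omega] at hm
      exact hm
  · have hs := Nat.find_spec hex
    calc r / L ^ 70 < L ^ 34 * (16 * L ^ 20) ^ (Nat.find hex + 1) := hs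
      _ = 16 * L ^ 20 * (L ^ 34 * (16 * L ^ 20) ^ Nat.find hex) := by ring

/-- **Harmonic stability implies the reduced excess decay** (see the module docstring). [folklore] -/
theorem excessDecayReducedAt_of
    (hPS : Summit.AtomisticToContinuum.Crystallization.Theses.ExcessDecayLiouville.PhononStability)
    {δ : ℝ} (hδ : 0 < δ) (hδ1 : δ ≤ 1) : ExcessDecayReducedAt δ := by
  classical
  -- coercivity with a constant κ ≤ 1
  obtain ⟨κ', hκ'0, hcoer⟩ := coercive_of_phononStability hPS
  obtain ⟨κ, hκdef⟩ : ∃ κ : ℝ, κ = min κ' 1 := ⟨_, rfl⟩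
  have hκ0 : 0 < κ := by rw [hκdef]; exact lt_min hκ'0 one_pos
  have hκ1 : κ ≤ 1 := by rw [hκdef]; exact min_le_right _ _
  have hκκ' : κ ≤ κ' := by rw [hκdef]; exact min_le_left _ _
  obtain ⟨hL, hκL, -⟩ := lcOf_ge hκ0 hκ1
  set L := lcOf κ with hLdef
  have hL1 : (1 : ℝ) ≤ L := by linarith
  have hL0 : (0 : ℝ) < L := by linarith
  refine ⟨δ / L ^ 1000, 1 / (64 * L ^ 90), L ^ 1000 / δ ^ 10, L ^ 400 / δ ^ 10, by positivity, by positivity, ?_,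
    by positivity, ?_⟩
  · rw [div_lt_one (by positivity)]
    have : (1 : ℝ) ≤ L ^ 90 := one_le_pow₀ hL1
    linarith
  intro X hX hsep hequil c t A r ε hA hI hr₀ hε hεε₀ hreg hNear
  -- the regime
  have hε0 : 0 ≤ ε := hε.le
  have hε' : L ^ 1000 * ε ≤ δ := by rw [le_div_iff₀ (by positivity)] at hεε₀; linarith
  have hr' : L ^ 1000 ≤ δ ^ 10 * r := by rw [div_le_iff₀ (by positivity)] at hr₀; linarith
  obtain ⟨hε20, hεδ, hε23, hr400, hr47, hr192⟩ := basic_conds hL hδ hδ1 hr' hε0 hε'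
  have hr0 : 0 < r := by linarith
  have hr1 : (1 : ℝ) ≤ r := by linarith
  have hr4 : (4 : ℝ) ≤ r := by linarith
  have hr64 : (64 : ℝ) ≤ r := by linarith
  -- coercivity for (t, A) with κ
  have hκ : ∀ v : E3 → E3, (Function.support v).Finite →
      Function.support v ⊆ Sites₀ t A → κ * nnForm t A v ≤ ∑' p : Sites₀ t A,
        ⟪tsum (fun q : Sites₀ t A => (if ((p : Sites₀ t A) : E3) ≠ q then
          𝕂[((p : Sites₀ t A) : E3) - q] (v ((p : Sites₀ t A) : E3) - v q) else 0)), v p⟫ :=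
    fun v hv hvS => (mul_le_mul_of_nonneg_right hκκ' (nnForm_nonneg t A v)).trans (hcoer t A hA hI v hv hvS)
  -- the matching map and the sites of the ball
  obtain ⟨hXb, hS⟩ := hNear
  obtain ⟨π, hπ, hinj⟩ := exists_matching hA hI hε23 hS
  obtain ⟨SR, hSR⟩ : ∃ SR : Finset E3, ∀ x, x ∈ SR ↔ x ∈ Sites₀ t A ∧ dist x c ≤ r :=
    ⟨(finite_sites_dist_le hA hI c r).toFinset, fun x => by simp⟩
  have hsep' : ∀ p ∈ X, ∀ q ∈ X, p ≠ q → δ ≤ dist p q := hsep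
  -- the base relaxation
  have hG := norm_selfForce_zero_le hA hI hX hsep' hδ hδ1 hε0 hεδ hε20 hr4 hequil hXb hπ hinj SR hSR
  have hGrhs := selfForce_rhs_le hr4 hε0 hε20 hδ hδ1
  have hGκ := (hG.trans hGrhs).trans (base_cond hL hκ0 hκL hδ hδ1 hr' hε0 hε')
  obtain ⟨ξ₀, hξ₀, haff₀, hrel₀⟩ := base_relaxation hA hI hκ0 hκ1 hκ hGκ c
  have hξn : ‖ξ₀‖ ≤ 4 / κ * (3000000 * ε + 80000 / (δ ^ 3 * r ^ 4)) :=
    hξ₀.trans (mul_le_mul_of_nonneg_left (hG.trans hGrhs) (by positivity))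
  obtain ⟨hεp, hξn'⟩ := epsP_shape hL hκ0 hκL hδ hr0 hε0 hξn
  -- the displacement of the relaxed datum on the sites of the ball
  have hεpt : ∀ x ∈ SR, ‖(π x - x) - (fun x : E3 => (0 : E3) + (if (∃ z ∈ Λ₀, x = t 0 + A z) then ξ₀ else 0)) x‖ ≤ ε + ‖ξ₀‖ := by
    intro x hx
    obtain ⟨hxS, hxc⟩ := (hSR x).1 hx
    have h1 : ‖π x - x‖ ≤ ε := norm_matching_sub_le hπ hxS hxc
    have h2 : ‖(0 : E3) + (if (∃ z ∈ Λ₀, x = t 0 + A z) then ξ₀ else 0)‖ ≤ ‖ξ₀‖ := by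
      rw [zero_add]; split_ifs
      · exact le_rfl
      · rw [norm_zero]; exact norm_nonneg _
    exact (norm_sub_le _ _).trans (add_le_add h1 h2)
  -- the top scale of phase one
  obtain ⟨hρlo, hρhi, hρ64⟩ := rhoS_bounds hr47
  obtain ⟨σs, hσsdef⟩ : ∃ σs : ℝ, σs = Real.sqrt ((r - 153600) / 737600) := ⟨_, rfl⟩
  have hσs2 : σs ^ 2 = (r - 153600) / 737600 := by rw [hσsdef]; exact Real.sq_sqrt (by linarith)
  have hσsnn : 0 ≤ σs := by rw [hσsdef]; exact Real.sqrt_nonneg _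
  have hσ8 : 8 ≤ σs := by
    have h := Real.sqrt_le_sqrt (le_trans (by norm_num : ((8 : ℝ) ^ 2) ≤ 64) hρ64)
    rw [Real.sqrt_sq (by norm_num)] at h
    rw [hσsdef]; exact h
  have hσs0 : 0 < σs := by linarith
  have hσsr : 737600 * σs ^ 2 + 153600 = r := by rw [hσs2]; ring
  rw [← hσs2] at hρlo hρhi
  obtain ⟨γs, hγsdef⟩ : ∃ γs : ℝ, γs = (ε + ‖ξ₀‖) / σs ^ 3 := ⟨_, rfl⟩
  have hγs : γs * σs ^ 3 = ε + ‖ξ₀‖ := by rw [hγsdef, div_mul_cancel₀ _ (pow_ne_zero 3 hσs0.ne')]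
  have hγs0 : 0 ≤ γs := by rw [hγsdef]; positivity
  -- the displacement scale Du, the forcing floor and the global gradient scale
  obtain ⟨Du, hDu⟩ : ∃ Du : ℝ, Du = L ^ 30 * ε + L ^ 250 / (δ ^ 3 * r ^ 2) := ⟨_, rfl⟩
  obtain ⟨hξκ, hξj, hΛκ, CΛ, hDu20, hεpDu, hj100, hDu0⟩ := phase1_conds hL hκ0 hκL hδ hδ1 hr' hε0 hε' (norm_nonneg ξ₀) hξn' hεp hDu
  have hDule : Du ≤ L ^ 30 * ε + L ^ 250 / (δ ^ 3 * r ^ 2) := hDu.le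
  have hDu1 : Du ≤ 1 := hDu20.trans (by norm_num)
  have hΦ0 : 0 ≤ phiOf Du r δ := by unfold phiOf; positivity
  have hΦ : phiOf Du r δ ≤ 4 * L / (δ ^ 3 * r ^ 4) := phi_shape hL hδ hδ1 hr1 hDu0 hDu1 (phiOf_le hDu0 hr0 hδ hδ1)
  obtain ⟨Nt, hNtdef⟩ : ∃ Nt : ℝ, Nt = max 0 (ntotGen κ r δ ε Du (1 / L ^ 100) (1 / L ^ 100)) := ⟨_, rfl⟩
  have hNt0 : 0 ≤ Nt := by rw [hNtdef]; exact le_max_left _ _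
  obtain ⟨ν, hνdef⟩ : ∃ ν : ℝ, ν = Real.sqrt (Nt / r ^ 7) := ⟨_, rfl⟩
  have hν0 : 0 ≤ ν := by rw [hνdef]; exact Real.sqrt_nonneg _
  have hN : ntotGen κ r δ ε Du (1 / L ^ 100) (1 / L ^ 100) ≤ ν ^ 2 * r ^ 7 := by
    rw [hνdef, Real.sq_sqrt (by positivity), div_mul_cancel₀ _ (by positivity), hNtdef]
    exact le_max_right _ _
  have hj0' : (0 : ℝ) ≤ 1 / L ^ 100 := by positivity
  have hNt : Nt ≤ (10 ^ 22 / κ) * (r * Du ^ 2 + Du / (δ ^ 3 * r)) := by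
    rw [hNtdef]
    exact max_le (by positivity) (ntotGen_le hκ0 hκ1 hr64 hDu0 hDu1 hj0' hj100 hj0' hj100 hε20 hδ hδ1)
  have hνs : ν ≤ 2 * L ^ 2 * (Du / r ^ 3 + 1 / (δ ^ 3 * r ^ 5)) := nu_shape hL hκ0 hκL hδ hr0 hDu0 hNt hνdef
  have hν' : ν ≤ 2 * L ^ 32 * ε / r ^ 3 + 3 * L ^ 252 / (δ ^ 3 * r ^ 5) :=
    nu_final hL hδ hr0 (by rw [hDu] at hνs; exact hνs)
  -- the aggregates of phase one
  have hSs : sAgg σs γs (phiOf Du r δ) Du r ν ≤ L ^ 3 * ε / r + L / (δ ^ 3 * r ^ 3) :=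
    sAgg_shapeF hL hδ hr400 hε0 hσ8 hρlo hρhi hγs hεp hDule hΦ0 hΦ hν0 hνs
  have hSs0 : 0 ≤ sAgg σs γs (phiOf Du r δ) Du r ν := by unfold sAgg; positivity
  have hS2 : γs / σs + phiOf Du r δ + Du / (σs ^ 2 * r ^ 2) + σs ^ 2 * ν ≤ L ^ 35 * ε / r ^ 2 + L ^ 253 / (δ ^ 3 * r ^ 4) :=
    s2Agg_shapeF hL hδ hr400 hε0 hσ8 hρlo hρhi hγs hεp hDule hΦ hν0 hνs
  have hVs : vAgg σs γs (phiOf Du r δ) Du r ≤ L ^ 3 * ε + L / (δ ^ 3 * r ^ 2) :=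
    vAgg_shapeF hL hδ hr400 hε0 hρhi hγs hεp hDu0 hDule hΦ0 hΦ
  have hsmall : L ^ 13 * sAgg σs γs (phiOf Du r δ) Du r ν ≤ κ ^ 2 / 10 ^ 11 :=
    (mul_le_mul_of_nonneg_left hSs (by positivity)).trans (hsmall_cond hL hκ0 hκL hδ hδ1 hr' hε0 hε')
  -- phase one
  obtain ⟨aff', a', B', K, s, W, Va, bT, haff', hrel', hK0, hK, hs0, hs, hW0, hW, hVa0, hVa, hbT0, hbT, hfresh, hprop,
      hB', hj', ha'm, hdisp⟩ :=
    phase_one hA hI hκ0 hκ1 hκ hX hsep hequil hδ hδ1 hε0 hεδ hr192 hXb hπ hinj SR hSR ξ₀ haff₀ hrel₀ (by positivity) hεpt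
      hσsr hσ8 hγs0 hγs hDu0 hDu20 hεpDu hν0 hN hξj hj100 hj0' CΛ hξκ hΛκ hsmall
  -- derived shapes
  obtain ⟨hK', hs', hbT', hVas', hΛ1'⟩ := derived_shapes hL hδ hr400 hε0 hSs hS2 hVs hK hs hbT hVa hξn' hDule
  -- the number of scales and the top scale of phase two
  have hL2 : (2 : ℝ) ≤ L := by linarith
  have hr104 : L ^ 104 ≤ r := (pow_le_pow_right₀ hL1 (by norm_num)).trans ((r_ge_of_regime hL1 hδ hδ1 hr'))
  obtain ⟨K₀, hρ₀hi, hρ₀lt⟩ := exists_scale_count hL2 hr104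
  obtain ⟨σ₀, hσ₀def⟩ : ∃ σ₀ : ℝ, σ₀ = L ^ 17 * (4 * L ^ 10) ^ K₀ := ⟨_, rfl⟩
  have hσ₀sq : σ₀ ^ 2 = L ^ 34 * (16 * L ^ 20) ^ K₀ := by
    have e : ((4 : ℝ) * L ^ 10) ^ 2 = 16 * L ^ 20 := by ring
    have e2 : (L ^ 17) ^ 2 = L ^ 34 := by ring
    rw [hσ₀def, mul_pow, pow_right_comm (4 * L ^ 10) K₀ 2, e, e2]
  rw [← hσ₀sq] at hρ₀hi hρ₀lt
  have hρ₀lo : r / (16 * L ^ 90) ≤ σ₀ ^ 2 := by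
    rw [div_le_iff₀ (by positivity)]
    rw [div_lt_iff₀ (by positivity)] at hρ₀lt
    have e : 16 * L ^ 20 * σ₀ ^ 2 * L ^ 70 = σ₀ ^ 2 * (16 * L ^ 90) := by ring
    rw [e] at hρ₀lt
    exact hρ₀lt.le
  have hσ₀0 : 0 < σ₀ := by rw [hσ₀def]; positivity
  have hL10 : (1 : ℝ) ≤ L ^ 10 := one_le_pow₀ hL1
  have h4L : (1 : ℝ) ≤ 4 * L ^ 10 := by linarith
  have hL17 : L ^ 17 ≤ σ₀ := by
    rw [hσ₀def]
    exact le_mul_of_one_le_right (by positivity) (one_le_pow₀ h4L)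
  have hσ₀1 : 1 ≤ σ₀ := le_trans (one_le_pow₀ hL1) hL17
  have hσ₀K : σ₀ / (4 * L ^ 10) ^ K₀ = L ^ 17 := by
    rw [hσ₀def, mul_div_assoc, div_self (by positivity), mul_one]
  -- the mass constant after phase one and the root constant γ₀
  obtain ⟨C₁, hC₁def⟩ : ∃ C₁ : ℝ, C₁ = 7 * K ^ 2 * σs ^ 2 + 6 * s ^ 2 / (σ₀ ^ 2) ^ 3 + W / (16 * (σ₀ ^ 2) ^ 6) +
      2 * (ε + ‖ξ₀‖) ^ 2 / σs ^ 6 + 4 * (Va + s) ^ 2 / σs ^ 6 + (21 / 5) * bT ^ 2 / σs ^ 2 := ⟨_, rfl⟩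
  have hC₁0 : 0 ≤ C₁ := by rw [hC₁def]; positivity
  obtain ⟨γ₀, hγ₀def⟩ : ∃ γ₀ : ℝ, γ₀ = Real.sqrt (64 * (7 * K ^ 2 * σs ^ 2 + 6 * s ^ 2 / (σ₀ ^ 2) ^ 3 + W / (16 * (σ₀ ^ 2) ^ 6) +
      2 * (ε + ‖ξ₀‖) ^ 2 / σs ^ 6 + 4 * (Va + s) ^ 2 / σs ^ 6 + (21 / 5) * bT ^ 2 / σs ^ 2) +
      L ^ 114 * floorAgg σ₀ (phiOf Du r δ) ν Du r) := ⟨_, rfl⟩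
  have hγ₀0 : 0 ≤ γ₀ := by rw [hγ₀def]; exact Real.sqrt_nonneg _
  have hfl0 : 0 ≤ floorAgg σ₀ (phiOf Du r δ) ν Du r := by unfold floorAgg; positivity
  have hγ₀sq : γ₀ ^ 2 = 64 * C₁ + L ^ 114 * floorAgg σ₀ (phiOf Du r δ) ν Du r := by
    rw [hγ₀def, hC₁def, Real.sq_sqrt (by positivity)]
  have hγC : 64 * C₁ ≤ γ₀ ^ 2 := by
    rw [hγ₀sq]; exact le_add_of_nonneg_right (mul_nonneg (pow_nonneg hL0.le 114) hfl0)
  have C5 : L ^ 114 * floorAgg σ₀ (phiOf Du r δ) ν Du r ≤ γ₀ ^ 2 := by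
    rw [hγ₀sq]; exact le_add_of_nonneg_left (by positivity)
  -- the budgets
  obtain ⟨hsideB, hMa1, hb2, hgeo1, hgeo2, hρ₀64, hσ₀r, hρ₀4, hρ₀8⟩ :=
    final_side (ξn := ‖ξ₀‖) (Va := Va) (s := s) hL hδ hδ1 hr' hε0 hε' hreg hξn' hVas' hbT' hρ₀lo hρ₀hi
  obtain ⟨hGU, hGV⟩ := gamma_budgets hL hδ hδ1 hr400 hr' hε0 hε' hσ8 hρlo hρhi hγs (by positivity) hεp hK0 hK' hs0 hs' hW
    (by positivity) hVas' hbT0 hbT' (by unfold lamOf; positivity) hΛ1' hΦ0 hΦ hν0 hν' hDu0 hDule hσ₀1 hρ₀lo hρ₀hi hγ₀def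
  obtain ⟨hUst, hUmax, hVst⟩ := budget_shapes hL hδ hr400 hε0 hρ₀hi hGU hGV hΦ0 hΦ hν0 hν' hDu0 hDule
  obtain ⟨Ustar, hUstar⟩ : ∃ Ustar : ℝ, Ustar = 2 * (γ₀ * σ₀) + 2 * (σ₀ ^ 2 * (phiOf Du r δ + ν)) := ⟨_, rfl⟩
  obtain ⟨Vstar, hVstar⟩ : ∃ Vstar : ℝ, Vstar = 2 * vAgg σ₀ γ₀ (phiOf Du r δ) Du r := ⟨_, rfl⟩
  rw [← hUstar] at hUst hUmax; rw [← hVstar] at hVst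
  have hUs0 : 0 ≤ Ustar := by rw [hUstar]; positivity
  have hUU : Ustar ≤ Ustar + Du / r ^ 2 := le_add_of_nonneg_right (by positivity)
  obtain ⟨C1, C2a, Cja, C2b, Cjb, C2c, C3, C4a, C4c, hΛ57⟩ := chain_conds (Va := Va) (s := s) hL hκ0 hκL hδ hδ1 hr' hε0 hε'
    (norm_nonneg ξ₀) hξn' hεp hSs0 hSs hUs0 hUU hUmax hVst hbT0 hbT' hVas' hDu
  have hΛs0 : 0 ≤ lamOf Du (1 / L ^ 100) (1 / L ^ 100) := by unfold lamOf; positivity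
  have hΛs57 : lamOf Du (1 / L ^ 100) (1 / L ^ 100) ≤ 1 / L ^ 57 := by unfold lamOf; exact hΛ57
  have C4b := lamOf_mono (Du := Du) Cja Cjb
  have C4c' : L ^ 113 * (lamOf Du (1 / L ^ 100) (1 / L ^ 100)) ^ 2 ≤ 1 := by unfold lamOf; exact C4c
  have hfin := final_height hL hδ hδ1 hr' hε0 hVst (hUs0.trans hUU) hUmax hΦ hDu hΛs57
  have hU : 2 * (γ₀ * σ₀) + 2 * (σ₀ ^ 2 * (phiOf Du r δ + ν)) ≤ Ustar := hUstar.ge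
  have hV : 2 * vAgg σ₀ γ₀ (phiOf Du r δ) Du r ≤ Vstar := hVstar.ge
  -- the masses of the phase-one field about c on [σ₀², r/2]
  have hmass₀ : ∀ Y : ℝ, 1 ≤ Y → σ₀ ^ 2 ≤ Y → Y ≤ r / 2 →
      (∑' p : Sites₀ t A, ‖(fun x : E3 => (fun x : EuclideanSpace ℝ (Fin 3) =>
        (if x ∈ Sites₀ t A then max (min 1 ((r / 2 + r / 4 - dist x c) / (r / 4))) 0 else 0)) x •
          ((π x - x) - aff' x)) (p : E3)‖ ^ 2 * 𝟙ᵇ[p, c, Y]) ≤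
        32 * C₁ * Y ^ 6 := by
    intro Y h1 hlo _
    obtain ⟨hfr, hpr⟩ := phase1_constant_le (K := K) (s := s) (εp := ε + ‖ξ₀‖) (Va := Va) (bT := bT) hW0 hρ₀64 hσ8 hlo
    rw [hC₁def]
    rcases le_total Y (σs ^ 2) with hY | hY
    · exact (hfresh Y h1 hY).trans (hfr hY)
    · exact (hprop Y h1 hY).trans (hpr hY)
  -- the pointwise bound at every site of B_{σ₀²}(c)
  have hpt : ∀ s' ∈ Sites₀ t A, dist s' c ≤ σ₀ ^ 2 → ‖(π s' - s') - aff' s'‖ ≤ ε / 2 + (L ^ 400 / δ ^ 10) / r ^ 2 := by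
    intro s' hs' hsd
    have h := pointwise_bound hA hI hκ0 hκ1 hκ hX hsep hequil hδ hδ1 hε0 hεδ hr192 hXb hπ hinj SR hSR haff' hrel' hC₁0 hmass₀
      hρ₀4 hρ₀8 hL17 hσ₀K hDu0 hDu20 hν0 hγ₀0 hγC hB' hj' hU hV hN Cja hj100 Cjb CΛ hσ₀r hdisp C1 C2a C2b C2c C3 C4a C4b C4c'
      hΛs0 C5 hs' hsd
    have e6 : (lcOf κ ^ 17) ^ 6 = lcOf κ ^ 102 := by ring
    have e7 : (lcOf κ ^ 17) ^ 7 = lcOf κ ^ 119 := by ring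
    have e4 : (lcOf κ ^ 17) ^ 4 = lcOf κ ^ 68 := by ring
    rw [e6, e7, e4] at h
    exact h.trans hfin
  -- the endgame
  have hMa0 : 0 ≤ ‖ξ₀‖ + Va + bT * (11 / 10) + s := by positivity
  have hnear := near_of_envelope (X := X) (aff := aff') hsep' hε0 hεδ hXb hπ haff' (R' := 1 / (64 * L ^ 90) * r)
    (Ma := ‖ξ₀‖ + Va + bT * (11 / 10) + s) (η := ε / 2 + (L ^ 400 / δ ^ 10) / r ^ 2) (by positivity) ha'm hMa0
    (hB'.trans hb2) hgeo2 (fun s' hs' hsd' => hpt s' hs' (hsd'.trans hgeo1))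
  refine ⟨fun m => t m + a' m + B' (t m - c), A + B'.comp A, ?_, hnear⟩
  calc ‖(A + B'.comp A) - A‖ ≤ ‖B'‖ := norm_displacedCell_sub_le hA B'
    _ ≤ bT := hB'
    _ ≤ (L ^ 400 / δ ^ 10) * ε / r := hsideB

end

/-- **The item `ExcessDecay`**: harmonic stability implies excess decay at every separation. [folklore] -/
theorem excessDecay_proof : Summit.AtomisticToContinuum.Crystallization.Theses.ExcessDecayLiouville.ExcessDecay :=
  excessDecay_of_reduced fun hPS _δ hδ hδ1 => excessDecayReducedAt_of hPS hδ hδ1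

end Summit.AtomisticToContinuum.Crystallization.Theorems.ExcessDecayLiouville

end
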